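import Mathlib.Analysis.InnerProductSpace.PiL2
import Mathlib.Algebra.Field.NegOnePow
import Literature.AlgebraicGeometry.Motives.HodgeStructureK3TypeAdjointProofs
import Literature.AlgebraicGeometry.Motives.HodgeStructureProofs
import HarnessLib

/-!
# Graded bases of `V_ℂ` orthonormal for the Hodge form (Mumford–Tate invariants, step 14)

For a pure `ℚ`-Hodge structure `H` of weight `n` on a finite-dimensional `V` with a polarization
`Q`, the Hodge form `h(x, y) = i^{p-q} Q_ℂ(x, conj y)` is a positive definite hermitian form on each
Hodge piece `V^{p,q}` (second Hodge–Riemann relation, `Polarization.pos`), and distinct pieces are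
`Q_ℂ(·, conj ·)`-orthogonal (`Polarization.form_piece_conj_piece`). Applying Gram–Schmidt
(Mathlib's `stdOrthonormalBasis` of the inner product space `InnerProductSpace.ofCore h`) in
each piece and collecting (`DirectSum.IsInternal.collectedBasis`, Hodge decomposition
`V_ℂ = ⊕ V^{p,n-p}` of `HodgeStructureProofs`) gives `exists_orthonormal_graded_basis`: a basis `e`
of `V_ℂ` with a degree `deg` such that `F^a = span {e σ | a ≤ deg σ}`,
`conj F^a = span {e σ | deg σ ≤ n - a}`, `e σ ∈ V^{deg σ, n - deg σ}` and

  `Q_ℂ(e σ, conj (e τ)) = δ_{στ} · (i^{deg σ} / i^{n - deg σ})⁻¹`.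

This is the classical "unitary frame adapted to the Hodge decomposition" (Voisin, *Hodge Theory
I*, §7.1.2; Green–Griffiths–Kerr, *Mumford–Tate groups and domains*, I.A) used to prove the
positivity of the induced polarization on tensor spaces.

## References

* C. Voisin, *Hodge Theory and Complex Algebraic Geometry I* (2002), §7.1.2, Def. 7.7.
* P. Deligne, *Théorie de Hodge II*, Publ. Math. IHÉS 40 (1971), 1.2.5, 2.1.15.
-/

noncomputable section

open scoped TensorProduct
open Complex

namespace Literature.AlgebraicGeometry.Motives

namespace HodgeStructure

universe u

variable {V : Type u} [AddCommGroup V] [Module ℚ V] {n : ℤ}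

/-! ### The Hodge sign `i^p / i^{n-p}` -/

/-- The unit `i^p · (i^{n-p})⁻¹ = i^{p-q}` multiplying `Q_ℂ(x, conj x)` in the second Hodge–Riemann
relation on `V^{p,n-p}` (tree convention of `Polarization.pos`). [folklore] -/
def hodgeSign (n p : ℤ) : ℂ := Complex.I ^ p * (Complex.I ^ (n - p))⁻¹

/-- `i^p / i^{n-p} ≠ 0`. [folklore] -/
theorem hodgeSign_ne_zero (n p : ℤ) : hodgeSign n p ≠ 0 :=
  mul_ne_zero (zpow_ne_zero _ I_ne_zero) (inv_ne_zero (zpow_ne_zero _ I_ne_zero))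

/-- `conj (i^p / i^{n-p}) · (-1)^n = i^p / i^{n-p}`. [folklore] -/
theorem conj_hodgeSign_mul_negOnePow (n p : ℤ) :
    starRingEnd ℂ (hodgeSign n p) * (((n.negOnePow : ℤˣ) : ℤ) : ℂ) = hodgeSign n p := by
  have hI : starRingEnd ℂ Complex.I = Complex.I⁻¹ := by rw [Complex.conj_I, Complex.inv_I]
  have hcz : ∀ m : ℤ, starRingEnd ℂ (Complex.I ^ m) = (Complex.I ^ m)⁻¹ := fun m => by
    rw [map_zpow₀, hI, inv_zpow]
  have hneg : (((n.negOnePow : ℤˣ) : ℤ) : ℂ) = (-1 : ℂ) ^ n := by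
    rw [← Int.cast_negOnePow ℂ n]
  have hI2 : ∀ m : ℤ, Complex.I ^ m * Complex.I ^ m = (-1 : ℂ) ^ m := fun m => by
    rw [← mul_zpow, Complex.I_mul_I]
  rw [hodgeSign, map_mul, map_inv₀, hcz, hcz, inv_inv, hneg]
  -- `(I^p)⁻¹ I^{n-p} (-1)^n = I^p (I^{n-p})⁻¹`
  have hp0 : Complex.I ^ p ≠ 0 := zpow_ne_zero _ I_ne_zero
  have hq0 : Complex.I ^ (n - p) ≠ 0 := zpow_ne_zero _ I_ne_zero
  field_simp
  -- goal of the shape `I^{n-p} (-1)^n I^{n-p} = I^p I^p` up to arrangement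
  have h1 : Complex.I ^ (n - p) * Complex.I ^ (n - p) = (-1 : ℂ) ^ (n - p) := hI2 _
  have h2 : Complex.I ^ p * Complex.I ^ p = (-1 : ℂ) ^ p := hI2 _
  have h3 : (-1 : ℂ) ^ (n - p) * (-1 : ℂ) ^ n = (-1 : ℂ) ^ p := by
    rw [← zpow_add₀ (by norm_num : (-1 : ℂ) ≠ 0)]
    rw [show n - p + n = p + 2 * (n - p) by ring, zpow_add₀ (by norm_num : (-1 : ℂ) ≠ 0),
      zpow_mul]
    norm_num
  linear_combination (-1 : ℂ) ^ n * h1 + h3 - h2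

/-! ### Orthonormal bases of the Hodge pieces -/

/-- **The Hodge form is positive definite hermitian on each piece; Gram–Schmidt.** For a
polarization `Q` and `p`, the piece `V^{p,n-p}` has a basis `b` with
`Q_ℂ(b i, conj (b j)) = δᵢⱼ (i^p / i^{n-p})⁻¹` (orthonormal for
`h(x, y) = (i^p / i^{n-p}) Q_ℂ(x, conj y)`; Voisin I, §7.1.2). [folklore] -/
theorem Polarization.exists_pieceBasis_orthonormal [Module.Finite ℚ V] {H : HodgeStructure V n}
    (Q : Polarization H) (p : ℤ) :
    ∃ (m : ℕ) (b : Module.Basis (Fin m) ℂ (H.piece p (n - p))),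
      ∀ i j, Q.form.baseChange ℂ (b i) (conj (b j : ℂ ⊗[ℚ] V)) =
        if i = j then (hodgeSign n p)⁻¹ else 0 := by
  set P := H.piece p (n - p) with hP
  set c := hodgeSign n p with hc
  -- the hermitian form `⟪x, y⟫ = c · Q_ℂ(y, conj x)` (conjugate-linear in `x`)
  have hherm : ∀ x y : ℂ ⊗[ℚ] V, starRingEnd ℂ (c * Q.form.baseChange ℂ x (conj y)) =
      c * Q.form.baseChange ℂ y (conj x) := by
    intro x y
    rw [map_mul, ← form_baseChange_conj, conj_conj, Q.form_baseChange_swap y (conj x), ← mul_assoc,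
      conj_hodgeSign_mul_negOnePow]
  have hpos : ∀ x : P, (x : ℂ ⊗[ℚ] V) ≠ 0 →
      ∃ r : ℝ, 0 < r ∧ c * Q.form.baseChange ℂ x (conj (x : ℂ ⊗[ℚ] V)) = r := fun x hx =>
    Q.pos p (n - p) (by ring) x x.2 hx
  let cd : InnerProductSpace.Core ℂ P :=
    { inner := fun x y => c * Q.form.baseChange ℂ (y : ℂ ⊗[ℚ] V) (conj (x : ℂ ⊗[ℚ] V))
      conj_inner_symm := fun x y => hherm _ _
      re_inner_nonneg := fun x => by
        change 0 ≤ (c * Q.form.baseChange ℂ (x : ℂ ⊗[ℚ] V) (conj (x : ℂ ⊗[ℚ] V))).re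
        by_cases hx : (x : ℂ ⊗[ℚ] V) = 0
        · simp [hx]
        · obtain ⟨r, hr, h⟩ := hpos x hx
          rw [h, Complex.ofReal_re]
          exact hr.le
      add_left := fun x y z => by
        change c * Q.form.baseChange ℂ (z : ℂ ⊗[ℚ] V) (conj ((x + y : P) : ℂ ⊗[ℚ] V)) = _
        rw [Submodule.coe_add, map_add, map_add, mul_add]
      smul_left := fun x y r => by
        change c * Q.form.baseChange ℂ (y : ℂ ⊗[ℚ] V) (conj ((r • x : P) : ℂ ⊗[ℚ] V)) = _
        rw [Submodule.coe_smul, conj_smul, map_smul, smul_eq_mul]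
        ring
      definite := fun x hx => by
        by_contra h0
        have hx0 : (x : ℂ ⊗[ℚ] V) ≠ 0 := fun h => h0 (Subtype.ext h)
        obtain ⟨r, hr, h⟩ := hpos x hx0
        change c * Q.form.baseChange ℂ (x : ℂ ⊗[ℚ] V) (conj (x : ℂ ⊗[ℚ] V)) = 0 at hx
        rw [hx] at h
        exact hr.ne' (Complex.ofReal_eq_zero.1 h.symm) }
  letI : NormedAddCommGroup P := @InnerProductSpace.Core.toNormedAddCommGroup ℂ P _ _ _ cd
  letI : InnerProductSpace ℂ P := InnerProductSpace.ofCore _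
  let b := stdOrthonormalBasis ℂ P
  have hb : ∀ i j, (inner ℂ (b i) (b j) : ℂ) = if i = j then 1 else 0 :=
    orthonormal_iff_ite.1 b.orthonormal
  have hb' : ∀ i j, c * Q.form.baseChange ℂ (b j : ℂ ⊗[ℚ] V) (conj (b i : ℂ ⊗[ℚ] V)) =
      if i = j then 1 else 0 := hb
  refine ⟨_, b.toBasis, fun i j => ?_⟩
  rw [OrthonormalBasis.coe_toBasis]
  have h := hb' j i
  by_cases hij : i = j
  · subst hij
    rw [if_pos rfl] at h ⊢
    exact (inv_eq_of_mul_eq_one_right h).symm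
  · rw [if_neg (Ne.symm hij)] at h
    rw [if_neg hij]
    exact (mul_eq_zero.1 h).resolve_left (hodgeSign_ne_zero n p)

/-! ### Graded bases from bases of the pieces -/

/-- **Collecting bases of the Hodge pieces gives a graded basis** (the basis form of the Hodge
decomposition, Deligne, *Théorie de Hodge II*, 1.2.5, for an ARBITRARY choice of bases of the
pieces `V^{i,n-i}`): `F^a = span {e σ | a ≤ deg σ}`, `conj F^a = span {e σ | deg σ ≤ n - a}`
with `deg = i` on the basis of `V^{i,n-i}`. [cite: DeligneHodgeII1971, 1.2.5] -/
theorem collectedBasis_graded (H : HodgeStructure V n) {κ : ℤ → Type*}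
    (hint : DirectSum.IsInternal fun i : ℤ => H.piece i (n - i))
    (v : ∀ i, Module.Basis (κ i) ℂ (H.piece i (n - i))) :
    (∀ a, H.F a = Submodule.span ℂ (hint.collectedBasis v '' {σ | a ≤ σ.1})) ∧
      ∀ a, complexConj (H.F a) =
        Submodule.span ℂ (hint.collectedBasis v '' {σ | σ.1 ≤ n - a}) := by
  classical
  set e := hint.collectedBasis v with he_def
  have hF : ∀ a : ℤ, H.F a = ⨆ (i : ℤ) (_ : a ≤ i), H.piece i (n - i) := F_eq_iSup_piece_holds H
  have he_mem : ∀ σ : Σ i, κ i, e σ ∈ H.piece σ.1 (n - σ.1) := fun σ =>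
    hint.collectedBasis_mem _ σ
  have hpiece : ∀ i, H.piece i (n - i) ≤ Submodule.span ℂ (e '' {σ | σ.1 = i}) := by
    intro i x hx
    rw [Module.Basis.mem_span_image]
    intro σ hσ
    by_contra hne
    rw [Finset.mem_coe, Finsupp.mem_support_iff] at hσ
    exact hσ (hint.collectedBasis_repr_of_mem_ne _ (Ne.symm hne) hx)
  refine ⟨fun a => ?_, fun a => ?_⟩
  · apply le_antisymm
    · rw [hF a]
      refine iSup₂_le fun i hi => (hpiece i).trans (Submodule.span_mono (Set.image_mono ?_))
      intro σ hσ
      simp only [Set.mem_setOf_eq] at hσ ⊢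
      omega
    · rw [Submodule.span_le]
      rintro _ ⟨σ, hσ, rfl⟩
      exact (piece_le_F H _ _).trans (H.antitone_F hσ) (he_mem σ)
  · apply le_antisymm
    · have h1 : complexConj (H.F a) = ⨆ (i : ℤ) (_ : a ≤ i), H.piece (n - i) i := by
        rw [hF a, ← complexConjOrderIso_apply, OrderIso.map_iSup]
        simp only [OrderIso.map_iSup, complexConjOrderIso_apply, complexConj_piece]
      rw [h1]
      refine iSup₂_le fun i hi => ?_
      have h2 : H.piece (n - i) i = H.piece (n - i) (n - (n - i)) := by rw [sub_sub_cancel]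
      rw [h2]
      refine (hpiece (n - i)).trans (Submodule.span_mono (Set.image_mono ?_))
      intro σ hσ
      simp only [Set.mem_setOf_eq] at hσ ⊢
      omega
    · rw [Submodule.span_le]
      rintro _ ⟨σ, hσ, rfl⟩
      simp only [Set.mem_setOf_eq] at hσ
      exact (piece_le_complexConj_F H _ _).trans (complexConj_mono (H.antitone_F (by omega)))
        (he_mem σ)

/-- **An `h`-orthonormal graded basis of `V_ℂ`.** For a polarization `Q` of `H` (on a
finite-dimensional `V`) there is a basis `e` of `V_ℂ` with a degree `deg` such that
`F^a = span {e σ | a ≤ deg σ}`, `conj F^a = span {e σ | deg σ ≤ n - a}`, `e σ ∈ V^{deg σ, n-deg σ}`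
and `Q_ℂ(e σ, conj (e τ)) = δ_{στ} (i^{deg σ} / i^{n - deg σ})⁻¹` (Gram–Schmidt for the Hodge
form in each piece, pieces mutually orthogonal by `Polarization.form_piece_conj_piece`;
Voisin I, §7.1.2). [folklore] -/
theorem Polarization.exists_orthonormal_graded_basis [Module.Finite ℚ V] {H : HodgeStructure V n}
    (Q : Polarization H) :
    ∃ (S : Type u) (_ : Fintype S) (_ : DecidableEq S) (deg : S → ℤ)
      (e : Module.Basis S ℂ (ℂ ⊗[ℚ] V)),
      (∀ a, H.F a = Submodule.span ℂ (e '' {σ | a ≤ deg σ})) ∧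
      (∀ a, complexConj (H.F a) = Submodule.span ℂ (e '' {σ | deg σ ≤ n - a})) ∧
      (∀ σ, e σ ∈ H.piece (deg σ) (n - deg σ)) ∧
      ∀ σ τ, Q.form.baseChange ℂ (e σ) (conj (e τ)) =
        if σ = τ then (hodgeSign n (deg σ))⁻¹ else 0 := by
  classical
  have hind : iSupIndep fun i : ℤ => H.piece i (n - i) := iSupIndep_piece_holds H
  have htop : (⨆ i : ℤ, H.piece i (n - i)) = ⊤ := iSup_piece_eq_top_holds H
  have hint : DirectSum.IsInternal fun i : ℤ => H.piece i (n - i) :=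
    DirectSum.isInternal_submodule_of_iSupIndep_of_iSup_eq_top hind htop
  choose m b hb using Q.exists_pieceBasis_orthonormal
  let e₀ : Module.Basis (Σ i, Fin (m i)) ℂ (ℂ ⊗[ℚ] V) := hint.collectedBasis b
  have he₀_mem : ∀ σ : Σ i, Fin (m i), e₀ σ ∈ H.piece σ.1 (n - σ.1) := fun σ =>
    hint.collectedBasis_mem _ σ
  have he₀_coe : ∀ σ : Σ i, Fin (m i), e₀ σ = (b σ.1 σ.2 : ℂ ⊗[ℚ] V) := fun σ =>
    congrFun (hint.collectedBasis_coe b) σ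
  obtain ⟨hF, hFc⟩ := collectedBasis_graded H hint b
  haveI : Fintype (Σ i, Fin (m i)) := FiniteDimensional.fintypeBasisIndex e₀
  -- reindex into the universe of `V`
  let ε : (Σ i, Fin (m i)) ≃ ULift.{u} (Σ i, Fin (m i)) := Equiv.ulift.symm
  let e : Module.Basis (ULift.{u} (Σ i, Fin (m i))) ℂ (ℂ ⊗[ℚ] V) := e₀.reindex ε
  have he : ∀ σ, e σ = e₀ σ.down := fun σ => by simp [e, ε, Module.Basis.reindex_apply]
  have himage : ∀ T : Set (Σ i, Fin (m i)), e '' {σ | σ.down ∈ T} = e₀ '' T := by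
    intro T
    ext x
    simp only [Set.mem_image, Set.mem_setOf_eq, he]
    constructor
    · rintro ⟨σ, hσ, rfl⟩
      exact ⟨σ.down, hσ, rfl⟩
    · rintro ⟨σ, hσ, rfl⟩
      exact ⟨ULift.up σ, hσ, rfl⟩
  refine ⟨ULift.{u} (Σ i, Fin (m i)), inferInstance, inferInstance, fun σ => σ.down.1, e,
    fun a => ?_, fun a => ?_, fun σ => ?_, fun σ τ => ?_⟩
  · rw [hF a, ← himage]
    rfl
  · rw [hFc a, ← himage]
    rfl
  · rw [he]
    exact he₀_mem σ.down
  · rw [he, he, he₀_coe, he₀_coe]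
    by_cases hst : σ.down.1 = τ.down.1
    · -- same piece: orthonormality of `b`
      obtain ⟨⟨i, s⟩⟩ := σ
      obtain ⟨⟨i', t⟩⟩ := τ
      simp only at hst
      subst hst
      rw [hb]
      by_cases hst' : s = t
      · subst hst'
        rw [if_pos rfl, if_pos rfl]
      · rw [if_neg hst', if_neg]
        intro h
        apply hst'
        cases h
        rfl
    · -- different pieces are orthogonal
      rw [Q.form_piece_conj_piece hst (b σ.down.1 σ.down.2).2 (b τ.down.1 τ.down.2).2, if_neg]
      intro h
      exact hst (by rw [h])

end HodgeStructure

end Literature.AlgebraicGeometry.Motives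

end
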